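import Literature.NumberTheory.Sieve.RosserSieveMajorantPackage
import HarnessLib

/-!
# Iwaniec's Lemma 13, I: the comparison `Q⁻ ≍ Q⁺` ((6.3)) and the one-step ratios ((6.4))

Topic `Literature/NumberTheory/Sieve`; Iwaniec, *Rosser's sieve*, Acta Arith. 36 (1980), §6. With
`a = Q⁺ + Q⁻ = majA`, `b = Q⁺ − Q⁻ = majB` (`RosserSieveLemma14.lean`) and Iwaniec's increasing adjoint
`G = adjG` this file PROVES, for parameters `κ > 0`, `β > 1` with `g(β − 1) = 0` and `g > 0` beyond
`β − 1` (the situation of the greatest `β`-sieve data of dimension `κ > 1/2`):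

* `exists_abs_majB_le` — **Lemma 14 with a constant `η < 1`**: `|b(s)| ≤ η a(s)` on `(0, ∞)`
  (Greaves, Lemma 4.3.3 (ii): on `(0, β + 1]` from (6.1) and `q⁻(β + 1) > 0` ((6.16)), beyond by the
  continuation argument with the pairings (6.12)–(6.13)); hence **(6.3)** `Q⁺ ≪ Q⁻ ≪ Q⁺`
  (`exists_QLower_le_QUpper`).
* `majA_sub_half_le`, `majA_sub_one_le` — **the right half of (6.4)**: `a(s − 1) ≤ (4s²/κ²) a(s)`
  (Greaves, Lemma 4.3.3 (iii)).
* `exists_adjG_add_one_le` — `G(s + 1) ≤ (1 + 32κ/s) G(s)` for large `s` (`g ∼ s^{2κ−1}`).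
* `exists_majA_sub_one_ge` — **the left half of (6.4)**: `κ a(s − 1) ≥ s (log s − L) a(s)` for
  large `s`, by a bootstrap on unit intervals: if `κ a(x − 1) ≥ x (log x − L) a(x)` on `[s − 1, s)` then
  (6.8) gives `−a' ≥ c a` there (`c = log(s − 1) − L`), so `∫_{s−1}^s a ≤ a(s − 1)(1 − e^{−c})/c`, and
  (6.12) (`s G(s) a(s) ≤ κ G(s + 1) ∫_{s−1}^s a`) closes the induction as soon as `e^L ≥ 32κ + 4`
  (the gain `c e^{−c} = c e^L/(s − 1)` beats the losses `O(c/s)`).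

Iwaniec proves (6.4)–(6.5) through Lemmas 15–16 (a de Bruijn-type analysis); the held copy of the
paper has no text layer, so the proofs here follow Greaves for (6.3) and the right half of (6.4) and
are the formaliser's own barrier arguments for the rest (the statements are Iwaniec's).

## References

* H. Iwaniec, *Rosser's sieve*, Acta Arith. 36 (1980), 171–202: §6, (6.3)–(6.4), (6.8), (6.12)–(6.13),
  Lemmas 13–15. [IwaniecActaArith1980]
* G. Greaves, *Sieves in Number Theory*, Springer (2001), §4.3.2, Lemma 4.3.3 (ii)–(iii) and its proof
  (pp. 93–95). [Greaves2001]
-/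

open Filter Set MeasureTheory intervalIntegral
open scoped Topology

noncomputable section

namespace Literature.NumberTheory.Sieve

open SieveAdjoint RosserMajorant BetaSieve

namespace RosserMajorant

variable {κ β : ℝ}

/-! ### Two calculus lemmas -/

/-- **Exponential decay from a differential inequality**: if `f` is continuous on `[u, v]` and
`f' ≤ −c f` on `(u, v)`, then `f(x) ≤ f(u) e^{−c (x − u)}` on `[u, v]`. [folklore] -/
theorem le_mul_exp_of_deriv_le {f f' : ℝ → ℝ} {u v c : ℝ} (hcont : ContinuousOn f (Icc u v))
    (hder : ∀ x ∈ Ioo u v, HasDerivAt f (f' x) x) (hle : ∀ x ∈ Ioo u v, f' x ≤ -c * f x)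
    {x : ℝ} (hx : x ∈ Icc u v) : f x ≤ f u * Real.exp (-c * (x - u)) := by
  -- `g(x) = f(x) e^{c (x - u)}` is non-increasing on `[u, v]`
  set g : ℝ → ℝ := fun y => f y * Real.exp (c * (y - u)) with hgdef
  have hgcont : ContinuousOn g (Icc u v) :=
    hcont.mul ((Real.continuous_exp.comp (continuous_const.mul (continuous_id.sub continuous_const))).continuousOn)
  have hgder : ∀ y ∈ Ioo u v, HasDerivAt g ((f' y + c * f y) * Real.exp (c * (y - u))) y := by
    intro y hy
    have he : HasDerivAt (fun z => Real.exp (c * (z - u))) (Real.exp (c * (y - u)) * (c * 1)) y :=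
      (((hasDerivAt_id y).sub_const u).const_mul c).exp
    have h := (hder y hy).mul he
    refine h.congr_deriv ?_
    ring
  have hanti : AntitoneOn g (Icc u v) := by
    refine antitoneOn_of_deriv_nonpos (convex_Icc u v) hgcont ?_ ?_
    · rw [interior_Icc]
      exact fun y hy => (hgder y hy).differentiableAt.differentiableWithinAt
    · rw [interior_Icc]
      intro y hy
      rw [(hgder y hy).deriv]
      have h1 : f' y + c * f y ≤ 0 := by linarith [hle y hy]
      exact mul_nonpos_of_nonpos_of_nonneg h1 (Real.exp_pos _).le
  have hgu : g x ≤ g u := hanti (left_mem_Icc.mpr (hx.1.trans hx.2)) hx hx.1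
  have hgu' : g u = f u := by simp [hgdef]
  rw [hgu'] at hgu
  have hexp : 0 < Real.exp (c * (x - u)) := Real.exp_pos _
  have : f x = g x * Real.exp (-c * (x - u)) := by
    simp only [hgdef]
    rw [mul_assoc, ← Real.exp_add, show c * (x - u) + -c * (x - u) = 0 by ring, Real.exp_zero, mul_one]
  rw [this]
  exact mul_le_mul_of_nonneg_right hgu (Real.exp_pos _).le

/-- `∫_u^{u+1} e^{−c (x − u)} dx = (1 − e^{−c})/c` for `c ≠ 0`. [folklore] -/
theorem integral_exp_neg_mul_sub {u c : ℝ} (hc : c ≠ 0) :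
    ∫ x in u..(u + 1), Real.exp (-c * (x - u)) = (1 - Real.exp (-c)) / c := by
  have hder : ∀ x ∈ uIcc u (u + 1),
      HasDerivAt (fun y => -(Real.exp (-c * (y - u))) / c) (Real.exp (-c * (x - u))) x := by
    intro x _
    have he : HasDerivAt (fun y => Real.exp (-c * (y - u))) (Real.exp (-c * (x - u)) * (-c * 1)) x :=
      (((hasDerivAt_id x).sub_const u).const_mul (-c)).exp
    have h := (he.neg).div_const c
    refine h.congr_deriv ?_
    field_simp
  have hcont : ContinuousOn (fun x => Real.exp (-c * (x - u))) (uIcc u (u + 1)) :=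
    (Real.continuous_exp.comp (continuous_const.mul (continuous_id.sub continuous_const))).continuousOn
  rw [integral_eq_sub_of_hasDerivAt hder hcont.intervalIntegrable]
  simp only [sub_self, mul_zero, Real.exp_zero, add_sub_cancel_left, mul_one]
  field_simp
  ring

/-- **Integral bound from exponential decay**: if `f` is continuous on `[u, u + 1]` with
`f' ≤ −c f` on `(u, u + 1)`, `c > 0`, then `∫_u^{u+1} f ≤ f(u) (1 − e^{−c})/c`. [folklore] -/
theorem integral_le_of_deriv_le {f f' : ℝ → ℝ} {u c : ℝ} (hc : 0 < c)
    (hcont : ContinuousOn f (Icc u (u + 1)))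
    (hder : ∀ x ∈ Ioo u (u + 1), HasDerivAt f (f' x) x) (hle : ∀ x ∈ Ioo u (u + 1), f' x ≤ -c * f x) :
    ∫ x in u..(u + 1), f x ≤ f u * ((1 - Real.exp (-c)) / c) := by
  have hmono : ∫ x in u..(u + 1), f x ≤ ∫ x in u..(u + 1), f u * Real.exp (-c * (x - u)) := by
    refine intervalIntegral.integral_mono_on (by linarith)
      (hcont.mono (by rw [uIcc_of_le (by linarith)])).intervalIntegrable ?_ fun x hx => ?_
    · exact (continuous_const.mul (Real.continuous_exp.comp
        (continuous_const.mul (continuous_id.sub continuous_const)))).intervalIntegrable _ _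
    · exact le_mul_exp_of_deriv_le hcont hder hle hx
  rw [intervalIntegral.integral_const_mul, integral_exp_neg_mul_sub hc.ne'] at hmono
  exact hmono

/-! ### `a = Q⁺ + Q⁻`, `b = Q⁺ − Q⁻` -/

/-- `a(s) = Q⁺(s) + Q⁻(s)`. [cite: IwaniecActaArith1980, §6 (p. 189)] -/
theorem majA_eq_QUpper_add_QLower (s : ℝ) : majA κ β s = QUpper κ β s + QLower κ β s := by
  rw [majA, QUpper_def, QLower_def, show (-κ - 1 : ℝ) = -(κ + 1) by ring]; ring

/-- `b(s) = Q⁺(s) − Q⁻(s)`. [cite: IwaniecActaArith1980, §6 (p. 189)] -/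
theorem majB_eq_QUpper_sub_QLower (s : ℝ) : majB κ β s = QUpper κ β s - QLower κ β s := by
  rw [majB, QUpper_def, QLower_def, show (-κ - 1 : ℝ) = -(κ + 1) by ring]; ring

section Main

variable (hκ : 0 < κ) (hβ : 1 < β) (h0 : qFun κ (β - 1) = 0)
  (hg : ∀ x : ℝ, β - 1 < x → 0 < qFun κ x)
include hκ hβ h0 hg

/-! ### Lemma 14 with `η < 1` and (6.3) -/

/-- **The initial interval**: for `0 < s ≤ β + 1`, `q⁺(s) = β^{−κ}` and
`0 < q⁻(β + 1) ≤ q⁻(s) ≤ (β − 1)^{−κ}`. [cite: IwaniecActaArith1980, §6 (6.1), (6.15)–(6.16)] -/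
theorem qLower_mem_Icc_of_le {s : ℝ} (hs : s ≤ β + 1) :
    qLower κ β (β + 1) ≤ qLower κ β s ∧ qLower κ β s ≤ (β - 1) ^ (-κ) := by
  have hanti : Antitone (qLower κ β) :=
    BetaSieve.qLower_antitone hκ.le hβ (fun u => (qUpper_pos_qLower_pos hκ hβ h0 hg u).1)
  refine ⟨hanti hs, ?_⟩
  have h := hanti (min_le_left s β)
  rwa [qLower_eq (min_le_right s β)] at h

/-- **Lemma 14 with a constant `η < 1`**: there is `η ∈ (0, 1)` with `|b(s)| ≤ η a(s)` for all
`s > 0` (Iwaniec's Lemma 14; Greaves, Lemma 4.3.3 (ii): the bound holds on `(0, β + 1]` by (6.1) and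
`q⁻(β + 1) > 0`, and at the first `u ≥ β + 1` where `|b(u)| = η a(u)` one would get
`u |b(u)| ≤ κ ∫_{u−1}^u |b| ≤ ηκ ∫_{u−1}^u a < (ηκ/G(u)) ∫_{u−1}^u G(x + 1) a(x) dx = η u a(u)`).
[cite: IwaniecActaArith1980, Lemma 14] -/
theorem exists_abs_majB_le :
    ∃ η : ℝ, 0 < η ∧ η < 1 ∧ ∀ s : ℝ, 0 < s → |majB κ β s| ≤ η * majA κ β s := by
  have hβ0 : 0 < β := by linarith
  -- the constants of the initial interval
  set p : ℝ := β ^ (-κ) with hp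
  set M : ℝ := (β - 1) ^ (-κ) with hM
  set m : ℝ := qLower κ β (β + 1) with hm
  have hp0 : 0 < p := Real.rpow_pos_of_pos hβ0 _
  have hM0 : 0 < M := Real.rpow_pos_of_pos (by linarith) _
  have hm0 : 0 < m := qLower_beta_add_one_pos hκ hβ h0 hg
  set δ : ℝ := min (1 / 2) (min (m / p) (p / M)) with hδ
  have hδ0 : 0 < δ := lt_min (by norm_num) (lt_min (div_pos hm0 hp0) (div_pos hp0 hM0))
  have hδ1 : δ ≤ 1 / 2 := min_le_left _ _
  have hδ2 : δ ≤ m / p := (min_le_right _ _).trans (min_le_left _ _)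
  have hδ3 : δ ≤ p / M := (min_le_right _ _).trans (min_le_right _ _)
  set η : ℝ := 1 - δ with hη
  have hη0 : 0 < η := by rw [hη]; linarith
  have hη1 : η < 1 := by rw [hη]; linarith
  -- the bound on `(0, β + 1]`
  have hinit : ∀ s, 0 < s → s ≤ β + 1 → |majB κ β s| ≤ η * majA κ β s := by
    intro s hs0 hs
    obtain ⟨hq1, hq2⟩ := qLower_mem_Icc_of_le hκ hβ h0 hg hs
    have hU : qUpper κ β s = p := qUpper_eq hs
    have hpow : 0 < s ^ (-κ - 1) := Real.rpow_pos_of_pos hs0 _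
    rw [majA, majB, abs_mul, abs_of_pos hpow, hU, mul_left_comm]
    refine mul_le_mul_of_nonneg_left (abs_le.mpr ⟨?_, ?_⟩) hpow.le
    · -- `q⁻ - p ≤ η (p + q⁻)` from `δ q⁻ ≤ δ M ≤ p`
      have h1 : δ * qLower κ β s ≤ p := by
        calc δ * qLower κ β s ≤ (p / M) * M :=
              mul_le_mul hδ3 hq2 (by linarith) (div_pos hp0 hM0).le
          _ = p := by field_simp
      rw [hη]; nlinarith
    · -- `p - q⁻ ≤ η (p + q⁻)` from `δ p ≤ m ≤ q⁻`
      have h1 : δ * p ≤ qLower κ β s := by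
        calc δ * p ≤ (m / p) * p := mul_le_mul_of_nonneg_right hδ2 hp0.le
          _ = m := by field_simp
          _ ≤ qLower κ β s := hq1
      rw [hη]; nlinarith
  refine ⟨η, hη0, hη1, ?_⟩
  -- continuation beyond `β + 1`
  by_contra hneg
  push Not at hneg
  obtain ⟨s, hs0, hs⟩ := hneg
  set S : Set ℝ := Ici (β + 1) ∩ (fun u => |majB κ β u| - η * majA κ β u) ⁻¹' (Ici 0) with hSdef
  have hsS : s ∈ S := by
    refine ⟨?_, ?_⟩
    · by_contra h
      exact absurd (hinit s hs0 (not_le.mp h).le) (not_le.mpr hs)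
    · show 0 ≤ |majB κ β s| - η * majA κ β s
      linarith
  have hne : S.Nonempty := ⟨s, hsS⟩
  have hbdd : BddBelow S := ⟨β + 1, fun u hu => hu.1⟩
  have hsub : Ici (β + 1) ⊆ Ioi (0:ℝ) := fun u (hu : β + 1 ≤ u) => show (0:ℝ) < u by linarith
  have hclosed : IsClosed S := by
    have hc : ContinuousOn (fun u => |majB κ β u| - η * majA κ β u) (Ici (β + 1)) :=
      ((continuousOn_majB hβ).mono hsub).abs.sub (continuousOn_const.mul ((continuousOn_majA hβ).mono hsub))
    exact hc.preimage_isClosed_of_isClosed isClosed_Ici isClosed_Ici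
  set u := sInf S with hudef
  have huS : u ∈ S := hclosed.csInf_mem hne hbdd
  have hle_of_mem : ∀ x ∈ S, u ≤ x := fun x hx => csInf_le hbdd hx
  have huβ : β + 1 ≤ u := huS.1
  have hu0 : 0 < u := by linarith
  have huS' : η * majA κ β u ≤ |majB κ β u| := by
    have := huS.2; simp only [mem_preimage, mem_Ici] at this; linarith
  -- the bound strictly below `u`
  have hlt : ∀ x, 0 < x → x < u → |majB κ β x| ≤ η * majA κ β x := by
    intro x hx0 hxu
    by_contra hx
    rcases le_or_gt x (β + 1) with h | h
    · exact hx (hinit x hx0 h)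
    · have := hle_of_mem x ⟨h.le, by
        show 0 ≤ |majB κ β x| - η * majA κ β x
        linarith [not_le.mp hx]⟩
      linarith
  -- the pairings at `u`
  have hA := pairA_eq_zero hκ hβ h0 huβ
  have hB := pairB_eq_zero hκ hβ huβ
  rw [sieveInnerProduct] at hA hB
  have hcontA : ContinuousOn (majA κ β) (Icc (u - 1) u) :=
    (continuousOn_majA hβ).mono fun x hx => show (0:ℝ) < x by linarith [hx.1]
  have hcontB : ContinuousOn (majB κ β) (Icc (u - 1) u) :=
    (continuousOn_majB hβ).mono fun x hx => show (0:ℝ) < x by linarith [hx.1]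
  have hiA : IntervalIntegrable (majA κ β) volume (u - 1) u :=
    (hcontA.mono (by rw [uIcc_of_le (by linarith)])).intervalIntegrable
  have hiB : IntervalIntegrable (majB κ β) volume (u - 1) u :=
    (hcontB.mono (by rw [uIcc_of_le (by linarith)])).intervalIntegrable
  -- (i) `u |b(u)| ≤ κ η ∫ a`
  have h1 : u * |majB κ β u| ≤ κ * (η * ∫ x in (u - 1)..u, majA κ β x) := by
    have hBeq : u * majB κ β u = -κ * ∫ x in (u - 1)..u, majB κ β x := by
      have : ∫ x in (u - 1)..u, (1:ℝ) * majB κ β x = ∫ x in (u - 1)..u, majB κ β x :=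
        intervalIntegral.integral_congr fun x _ => one_mul _
      rw [this] at hB
      linarith
    have habs : |∫ x in (u - 1)..u, majB κ β x| ≤ ∫ x in (u - 1)..u, |majB κ β x| :=
      intervalIntegral.abs_integral_le_integral_abs (by linarith)
    have hmono : ∫ x in (u - 1)..u, |majB κ β x| ≤ ∫ x in (u - 1)..u, η * majA κ β x :=
      intervalIntegral.integral_mono_on_of_le_Ioo (by linarith) hiB.abs (hiA.const_mul η)
        fun x hx => hlt x (by linarith [hx.1]) hx.2
    rw [intervalIntegral.integral_const_mul] at hmono
    calc u * |majB κ β u| = |u * majB κ β u| := by rw [abs_mul, abs_of_pos hu0]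
      _ = κ * |∫ x in (u - 1)..u, majB κ β x| := by
          rw [hBeq, abs_mul, abs_neg, abs_of_pos hκ]
      _ ≤ κ * (η * ∫ x in (u - 1)..u, majA κ β x) :=
          mul_le_mul_of_nonneg_left (habs.trans hmono) hκ.le
  -- (ii) `G(u) ∫ a < ∫ G(x+1) a(x) dx = u G(u) a(u) / κ`
  have hGu : 0 < adjG κ β u := adjG_pos hκ hβ hg (by linarith)
  have h2 : adjG κ β u * ∫ x in (u - 1)..u, majA κ β x <
      ∫ x in (u - 1)..u, adjG κ β (x + 1) * majA κ β x := by
    rw [← intervalIntegral.integral_const_mul]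
    refine intervalIntegral.integral_lt_integral_of_continuousOn_of_le_of_exists_lt (by linarith)
      (continuousOn_const.mul hcontA)
      (((continuousOn_comp_add_one (continuousOn_adjG hβ)).mono fun x hx =>
        show (0:ℝ) < x by linarith [hx.1]).mul hcontA)
      (fun x hx => ?_) ⟨u - 1 / 2, ⟨by linarith, by linarith⟩, ?_⟩
    · exact mul_le_mul_of_nonneg_right
        (adjG_le_adjG hκ hβ hg (by linarith) (by linarith [hx.1]))
        (majA_pos hκ hβ h0 hg (by linarith [hx.1])).le
    · exact mul_lt_mul_of_pos_right
        (adjG_lt_adjG hκ hβ hg (by linarith) (by linarith)) (majA_pos hκ hβ h0 hg (by linarith))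
  have h3 : ∫ x in (u - 1)..u, adjG κ β (x + 1) * majA κ β x = u * adjG κ β u * majA κ β u / κ := by
    rw [eq_div_iff hκ.ne']; linarith
  -- combine
  have h4 : u * adjG κ β u * |majB κ β u| < u * adjG κ β u * (η * majA κ β u) := by
    have := mul_le_mul_of_nonneg_left h1 hGu.le
    have h2' := mul_lt_mul_of_pos_left h2 (mul_pos hκ hη0)
    rw [h3] at h2'
    have e : κ * η * (u * adjG κ β u * majA κ β u / κ) = u * adjG κ β u * (η * majA κ β u) := by
      field_simp
    rw [e] at h2'
    nlinarith
  have h5 : |majB κ β u| < η * majA κ β u := lt_of_mul_lt_mul_left h4 (by positivity)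
  linarith

/-- **(6.3): `Q⁺ ≪ Q⁻ ≪ Q⁺` on `(0, ∞)`**, together with `Q⁺ ≤ a ≤ (1 + c₂) Q⁺`: there are
`c₁, c₂ > 0` with `c₁ Q⁺ ≤ Q⁻ ≤ c₂ Q⁺` for all `s > 0`. [cite: IwaniecActaArith1980, Lemma 13 (6.3)] -/
theorem exists_QLower_le_QUpper :
    ∃ c₁ c₂ : ℝ, 0 < c₁ ∧ 0 < c₂ ∧ ∀ s : ℝ, 0 < s →
      c₁ * QUpper κ β s ≤ QLower κ β s ∧ QLower κ β s ≤ c₂ * QUpper κ β s ∧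
      QUpper κ β s ≤ majA κ β s ∧ majA κ β s ≤ (1 + c₂) * QUpper κ β s := by
  obtain ⟨η, hη0, hη1, hη⟩ := exists_abs_majB_le hκ hβ h0 hg
  refine ⟨(1 - η) / (1 + η), (1 + η) / (1 - η), div_pos (by linarith) (by linarith),
    div_pos (by linarith) (by linarith), fun s hs => ?_⟩
  have h := hη s hs
  rw [majA_eq_QUpper_add_QLower, majB_eq_QUpper_sub_QLower] at h
  obtain ⟨h1, h2⟩ := abs_le.mp h
  have hpow : 0 < s ^ (-(κ + 1)) := Real.rpow_pos_of_pos hs _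
  have hU : 0 < QUpper κ β s := by
    rw [QUpper_def]; exact mul_pos hpow (qUpper_pos_qLower_pos hκ hβ h0 hg s).1
  have hL : 0 < QLower κ β s := by
    rw [QLower_def]; exact mul_pos hpow (qUpper_pos_qLower_pos hκ hβ h0 hg s).2
  have hQL : QLower κ β s ≤ (1 + η) / (1 - η) * QUpper κ β s := by
    rw [div_mul_eq_mul_div, le_div_iff₀ (by linarith)]; nlinarith
  refine ⟨?_, hQL, ?_, ?_⟩
  · rw [div_mul_eq_mul_div, div_le_iff₀ (by linarith)]; nlinarith
  · rw [majA_eq_QUpper_add_QLower]; linarith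
  · rw [majA_eq_QUpper_add_QLower]; linarith

/-! ### The right half of (6.4): `a(s − 1) ≪ s² a(s)` -/

/-- **`a(s − 1/2) ≤ (2s/κ) a(s)` for `s ≥ β + 2`** (Greaves, proof of Lemma 4.3.3 (iii): in
`s G(s) a(s) = κ ∫_{s−1}^s G(x + 1) a(x) dx` keep `x ≤ s − 1/2`, where `G(x + 1) ≥ G(s)` and
`a(x) ≥ a(s − 1/2)`). [cite: Greaves2001, Lemma 4.3.3 (iii)] -/
theorem majA_sub_half_le {s : ℝ} (hs : β + 2 ≤ s) :
    majA κ β (s - 1 / 2) ≤ 2 * s / κ * majA κ β s := by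
  have hs0 : 0 < s := by linarith
  have hA := pairA_eq_zero hκ hβ h0 (by linarith : β + 1 ≤ s)
  rw [sieveInnerProduct] at hA
  set F : ℝ → ℝ := fun x => adjG κ β (x + 1) * majA κ β x with hF
  have hcont : ContinuousOn F (Ioi 0) :=
    (continuousOn_comp_add_one (continuousOn_adjG hβ)).mul (continuousOn_majA hβ)
  have hint : ∀ a b : ℝ, 0 < a → 0 < b → IntervalIntegrable F volume a b := by
    intro a b ha hb
    refine (hcont.mono fun x hx => ?_).intervalIntegrable
    rcases le_total a b with hab | hab
    · rw [uIcc_of_le hab] at hx; exact lt_of_lt_of_le ha hx.1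
    · rw [uIcc_of_ge hab] at hx; exact lt_of_lt_of_le hb hx.1
  have hsplit : ∫ x in (s - 1)..s, F x =
      (∫ x in (s - 1)..(s - 1 / 2), F x) + ∫ x in (s - 1 / 2)..s, F x :=
    (integral_add_adjacent_intervals (hint _ _ (by linarith) (by linarith))
      (hint _ _ (by linarith) hs0)).symm
  have hGpos : ∀ x, β ≤ x → 0 < adjG κ β x := fun x hx => adjG_pos hκ hβ hg hx
  have h2 : 0 ≤ ∫ x in (s - 1 / 2)..s, F x :=
    intervalIntegral.integral_nonneg (by linarith) fun x hx =>
      mul_nonneg (hGpos (x + 1) (by linarith [hx.1])).le (majA_pos hκ hβ h0 hg (by linarith [hx.1])).le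
  have h1 : ∫ x in (s - 1)..(s - 1 / 2), adjG κ β s * majA κ β (s - 1 / 2) ≤
      ∫ x in (s - 1)..(s - 1 / 2), F x := by
    refine intervalIntegral.integral_mono_on (by linarith) intervalIntegrable_const
      (hint _ _ (by linarith) (by linarith)) fun x hx => ?_
    exact mul_le_mul (adjG_le_adjG hκ hβ hg (by linarith) (by linarith [hx.1]))
      (majA_antitoneOn hκ hβ h0 hg (show β + 1 ≤ x by linarith [hx.1])
        (show β + 1 ≤ s - 1 / 2 by linarith) hx.2)
      (majA_pos hκ hβ h0 hg (by linarith)).le (hGpos (x + 1) (by linarith [hx.1])).le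
  rw [intervalIntegral.integral_const, smul_eq_mul, show s - 1 / 2 - (s - 1) = (1 / 2 : ℝ) by ring] at h1
  have hGs := hGpos s (by linarith)
  have has := majA_pos hκ hβ h0 hg hs0
  -- `s G(s) a(s) = κ ∫ F ≥ κ G(s) a(s - 1/2) / 2`
  have h3 : κ * (1 / 2 * (adjG κ β s * majA κ β (s - 1 / 2))) ≤ s * adjG κ β s * majA κ β s := by
    have : s * adjG κ β s * majA κ β s = κ * ∫ x in (s - 1)..s, F x := by linarith
    rw [this, hsplit]
    exact mul_le_mul_of_nonneg_left (by linarith) hκ.le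
  rw [div_mul_eq_mul_div, le_div_iff₀ hκ]
  have h4 : adjG κ β s * (majA κ β (s - 1 / 2) * κ) ≤ adjG κ β s * (2 * s * majA κ β s) := by
    nlinarith
  exact le_of_mul_le_mul_left h4 hGs

/-- **The right half of (6.4) for `a`**: `a(s − 1) ≤ (4s²/κ²) a(s)` for `s ≥ β + 5/2`
(`majA_sub_half_le` twice; Greaves, Lemma 4.3.3 (iii): `U(s − 1) ≪ s² U(s)`).
[cite: Greaves2001, Lemma 4.3.3 (iii)] -/
theorem majA_sub_one_le {s : ℝ} (hs : β + 5 / 2 ≤ s) :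
    majA κ β (s - 1) ≤ 4 * s ^ 2 / κ ^ 2 * majA κ β s := by
  have hs0 : 0 < s := by linarith
  have h1 := majA_sub_half_le hκ hβ h0 hg (s := s - 1 / 2) (by linarith)
  have h2 := majA_sub_half_le hκ hβ h0 hg (s := s) (by linarith)
  rw [show s - 1 / 2 - 1 / 2 = s - 1 by ring] at h1
  have has := majA_pos hκ hβ h0 hg hs0
  have hpos : 0 ≤ 2 * (s - 1 / 2) / κ := div_nonneg (by linarith) hκ.le
  calc majA κ β (s - 1) ≤ 2 * (s - 1 / 2) / κ * majA κ β (s - 1 / 2) := h1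
    _ ≤ 2 * (s - 1 / 2) / κ * (2 * s / κ * majA κ β s) := mul_le_mul_of_nonneg_left h2 hpos
    _ ≤ 2 * s / κ * (2 * s / κ * majA κ β s) := by
        refine mul_le_mul_of_nonneg_right ?_ (by positivity)
        exact div_le_div_of_nonneg_right (by linarith) hκ.le
    _ = 4 * s ^ 2 / κ ^ 2 * majA κ β s := by field_simp; ring

/-! ### The growth of `G`: `G(s + 1) ≤ (1 + 32κ/s) G(s)` -/

omit h0 in
/-- **`G(s + 1) ≤ (1 + 32κ/s) G(s)` for large `s`**: `G(s + 1) − G(s) = 2κ ∫_s^{s+1} g ≤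
2 ((s + 1)^{2κ} − s^{2κ}) ≤ 8κ s^{2κ−1}` and `G(s) ≥ s^{2κ}/4` (`g ≤ 2 s^{2κ−1}` eventually).
[cite: Greaves2001, (4.2.3.13)] -/
theorem exists_adjG_add_one_le :
    ∃ s₀ : ℝ, β + 2 ≤ s₀ ∧ ∀ s : ℝ, s₀ ≤ s → adjG κ β (s + 1) ≤ (1 + 32 * κ / s) * adjG κ β s := by
  obtain ⟨s₀, hs₀β, hs₀⟩ := exists_adjG_ge hκ hβ hg
  refine ⟨max s₀ (2 * κ + 1), le_max_of_le_left hs₀β, fun s hs => ?_⟩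
  have hs0s : s₀ ≤ s := (le_max_left _ _).trans hs
  have hs2κ : 2 * κ + 1 ≤ s := (le_max_right _ _).trans hs
  have hs0 : 0 < s := by linarith
  obtain ⟨-, hGs⟩ := hs₀ s hs0s
  have hdiff := adjG_sub_adjG (κ := κ) (β := β) hβ hs0 (by linarith : 0 < s + 1)
  -- `∫_s^{s+1} g ≤ ∫_s^{s+1} 2 x^{2κ-1} = ((s+1)^{2κ} - s^{2κ})/κ`
  have hcont : ContinuousOn (fun x : ℝ => 2 * x ^ (2 * κ - 1)) (Icc s (s + 1)) :=
    continuousOn_const.mul (continuousOn_id.rpow_const fun x hx =>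
      Or.inl (ne_of_gt (show (0:ℝ) < x by linarith [hx.1])))
  have hmono : ∫ x in s..(s + 1), qFun κ x ≤ ∫ x in s..(s + 1), 2 * x ^ (2 * κ - 1) :=
    intervalIntegral.integral_mono_on (by linarith) (intervalIntegrable_qFun hs0 (by linarith))
      (hcont.mono (by rw [uIcc_of_le (by linarith)])).intervalIntegrable
      fun x hx => (hs₀ x (hs0s.trans hx.1)).1
  have hrpow : ∫ x in s..(s + 1), 2 * x ^ (2 * κ - 1) = ((s + 1) ^ (2 * κ) - s ^ (2 * κ)) / κ := by
    rw [intervalIntegral.integral_const_mul, integral_rpow (Or.inl (by linarith)),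
      show (2 * κ - 1 + 1 : ℝ) = 2 * κ by ring]
    field_simp
  -- `(s+1)^{2κ} ≤ s^{2κ} (1 + 4κ/s)`
  have hpow : 0 < s ^ (2 * κ) := Real.rpow_pos_of_pos hs0 _
  have hkey : (s + 1) ^ (2 * κ) ≤ s ^ (2 * κ) * (1 + 4 * κ / s) := by
    have e1 : (s + 1) ^ (2 * κ) = s ^ (2 * κ) * (1 + 1 / s) ^ (2 * κ) := by
      rw [← Real.mul_rpow hs0.le (by positivity)]
      congr 1
      field_simp
    have e2 : (1 + 1 / s) ^ (2 * κ) ≤ Real.exp (2 * κ / s) := by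
      calc (1 + 1 / s) ^ (2 * κ) ≤ (Real.exp (1 / s)) ^ (2 * κ) :=
            Real.rpow_le_rpow (by positivity) (by linarith [Real.add_one_le_exp (1 / s)]) (by linarith)
        _ = Real.exp (2 * κ / s) := by
            rw [← Real.exp_mul]; congr 1; field_simp
    have e3 : Real.exp (2 * κ / s) ≤ 1 + 4 * κ / s := by
      have hx : 2 * κ / s ≤ 1 := by rw [div_le_one hs0]; linarith
      have hx0 : 0 ≤ 2 * κ / s := by positivity
      have h := Real.abs_exp_sub_one_le (x := 2 * κ / s) (by rw [abs_of_nonneg hx0]; exact hx)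
      rw [abs_of_nonneg hx0] at h
      have := (abs_le.mp h).2
      have e : 2 * (2 * κ / s) = 4 * κ / s := by ring
      linarith
    rw [e1]
    exact mul_le_mul_of_nonneg_left (e2.trans e3) hpow.le
  -- assemble
  have hsκ : s ^ (2 * κ) * (4 * κ / s) = 4 * κ * (s ^ (2 * κ) / s) := by ring
  have hI : ∫ x in s..(s + 1), qFun κ x ≤ 4 * (s ^ (2 * κ) / s) := by
    rw [hrpow] at hmono
    refine hmono.trans ?_
    rw [div_le_iff₀ hκ]
    nlinarith
  have hG0 : 0 < adjG κ β s := by linarith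
  -- `G(s+1) - G(s) = 2κ ∫ g ≤ 8κ s^{2κ}/s ≤ 32 κ G(s)/s`
  have h1 : adjG κ β (s + 1) - adjG κ β s ≤ 2 * κ * (4 * (s ^ (2 * κ) / s)) := by
    rw [hdiff]; exact mul_le_mul_of_nonneg_left hI (by linarith)
  have h2 : s ^ (2 * κ) / s ≤ 4 * adjG κ β s / s := by
    refine div_le_div_of_nonneg_right ?_ hs0.le
    linarith
  have : (1 + 32 * κ / s) * adjG κ β s = adjG κ β s + 2 * κ * (4 * (4 * adjG κ β s / s)) := by
    field_simp
    ring
  rw [this]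
  nlinarith [mul_le_mul_of_nonneg_left h2 (by linarith : (0:ℝ) ≤ 2 * κ * 4)]

/-! ### The left half of (6.4): `κ a(s − 1) ≥ s (log s − L) a(s)` -/

omit hκ hβ h0 hg in
/-- `log s − log(s − 1) ≤ 1/(s − 1)` for `s > 1`. [folklore] -/
theorem log_sub_log_sub_one_le {s : ℝ} (hs : 1 < s) :
    Real.log s - Real.log (s - 1) ≤ 1 / (s - 1) := by
  have hne : s - 1 ≠ 0 := ne_of_gt (by linarith)
  have h1 : Real.log s - Real.log (s - 1) = Real.log (s / (s - 1)) := by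
    rw [Real.log_div (by linarith) hne]
  rw [h1]
  have h2 := Real.log_le_sub_one_of_pos (show 0 < s / (s - 1) by
    exact div_pos (by linarith) (by linarith))
  have h3 : s / (s - 1) - 1 = 1 / (s - 1) := by field_simp; ring
  linarith

/-- **The bootstrap step for the left half of (6.4)**. Let `G(t + 1) ≤ (1 + A/t) G(t)` for
`t ≥ s₁` (`A = 32κ`), `s ≥ max(s₁, 4A + 9, β + 3)`, `e^L ≥ A + 4`, and suppose
`x (log x − L) a(x) ≤ κ a(x − 1)` for `x ∈ [s − 1, s)`. Then `s (log s − L) a(s) < κ a(s − 1)`: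
trivially if `log s ≤ L`; otherwise, with `c = log(s − 1) − L`, either `c ≤ 1/2` and
`s a(s) ≤ κ (1 + A/s) a(s − 1)` suffices, or `−a' ≥ c a` on `(s − 1, s)` by (6.8),
`∫_{s−1}^s a ≤ a(s − 1)(1 − e^{−c})/c`, and `(c + 1/(s − 1))(1 + A/s)(1 − e^{−c}) < c` because
`c e^{−c} = c e^L/(s − 1) ≥ (cA + 4c)/(s − 1)`. [cite: IwaniecActaArith1980, Lemma 13 (6.4)] -/
theorem majA_step_of_forall {s₁ L s : ℝ}
    (hG : ∀ t : ℝ, s₁ ≤ t → adjG κ β (t + 1) ≤ (1 + 32 * κ / t) * adjG κ β t)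
    (hs₁ : s₁ ≤ s) (hsA : 4 * (32 * κ) + 9 ≤ s) (hsβ : β + 3 ≤ s)
    (hEL : 32 * κ + 4 ≤ Real.exp L)
    (hIH : ∀ x : ℝ, s - 1 ≤ x → x < s →
      x * (Real.log x - L) * majA κ β x ≤ κ * majA κ β (x - 1)) :
    s * (Real.log s - L) * majA κ β s < κ * majA κ β (s - 1) := by
  set A : ℝ := 32 * κ with hAdef
  have hA0 : 0 < A := by positivity
  have hs0 : 0 < s := by linarith
  have hs1 : 1 < s := by linarith
  have hAs : A / s ≤ 1 / 4 := by
    rw [div_le_iff₀ hs0]; linarith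
  have hAs0 : 0 ≤ A / s := by positivity
  have hGs : 0 < adjG κ β s := adjG_pos hκ hβ hg (by linarith)
  have has : 0 < majA κ β s := majA_pos hκ hβ h0 hg hs0
  have has1 : 0 < majA κ β (s - 1) := majA_pos hκ hβ h0 hg (by linarith)
  have hκa : 0 < κ * majA κ β (s - 1) := mul_pos hκ has1
  -- the trivial zone
  rcases le_or_gt (Real.log s) L with hsl | hsl
  · have : s * (Real.log s - L) * majA κ β s ≤ 0 :=
      mul_nonpos_of_nonpos_of_nonneg (mul_nonpos_of_nonneg_of_nonpos hs0.le (by linarith)) has.le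
    linarith
  have hlogL : 0 < Real.log s - L := by linarith
  -- (**) `s a(s) ≤ κ (1 + A/s) ∫_{s-1}^s a`
  have hPair := pairA_eq_zero hκ hβ h0 (by linarith : β + 1 ≤ s)
  rw [sieveInnerProduct] at hPair
  have hcontA : ContinuousOn (majA κ β) (Icc (s - 1) s) :=
    (continuousOn_majA hβ).mono fun x hx => show (0:ℝ) < x by linarith [hx.1]
  have hiA : IntervalIntegrable (majA κ β) volume (s - 1) s :=
    (hcontA.mono (by rw [uIcc_of_le (by linarith)])).intervalIntegrable
  have hcontF : ContinuousOn (fun x => adjG κ β (x + 1) * majA κ β x) (Icc (s - 1) s) :=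
    ((continuousOn_comp_add_one (continuousOn_adjG hβ)).mono fun x hx =>
      show (0:ℝ) < x by linarith [hx.1]).mul hcontA
  have hmonoF : ∫ x in (s - 1)..s, adjG κ β (x + 1) * majA κ β x ≤
      ∫ x in (s - 1)..s, adjG κ β (s + 1) * majA κ β x := by
    refine intervalIntegral.integral_mono_on (by linarith)
      (hcontF.mono (by rw [uIcc_of_le (by linarith)])).intervalIntegrable (hiA.const_mul _)
      fun x hx => ?_
    exact mul_le_mul_of_nonneg_right (adjG_le_adjG hκ hβ hg (by linarith [hx.1]) (by linarith [hx.2]))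
      (majA_pos hκ hβ h0 hg (by linarith [hx.1])).le
  rw [intervalIntegral.integral_const_mul] at hmonoF
  have hint0 : 0 ≤ ∫ x in (s - 1)..s, majA κ β x :=
    intervalIntegral.integral_nonneg (by linarith) fun x hx => (majA_pos hκ hβ h0 hg (by linarith [hx.1])).le
  have hstar : s * majA κ β s ≤ κ * (1 + A / s) * ∫ x in (s - 1)..s, majA κ β x := by
    have h1 : s * adjG κ β s * majA κ β s ≤ κ * (adjG κ β (s + 1) * ∫ x in (s - 1)..s, majA κ β x) := by
      have : s * adjG κ β s * majA κ β s = κ * ∫ x in (s - 1)..s, adjG κ β (x + 1) * majA κ β x := by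
        linarith
      rw [this]; exact mul_le_mul_of_nonneg_left hmonoF hκ.le
    have h2 : adjG κ β (s + 1) * ∫ x in (s - 1)..s, majA κ β x ≤
        (1 + A / s) * adjG κ β s * ∫ x in (s - 1)..s, majA κ β x :=
      mul_le_mul_of_nonneg_right (hG s hs₁) hint0
    have h3 : adjG κ β s * (s * majA κ β s) ≤
        adjG κ β s * (κ * (1 + A / s) * ∫ x in (s - 1)..s, majA κ β x) := by
      nlinarith [mul_le_mul_of_nonneg_left h2 hκ.le]
    exact le_of_mul_le_mul_left h3 hGs
  have hlog : Real.log s - L ≤ (Real.log (s - 1) - L) + 1 / (s - 1) := by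
    linarith [log_sub_log_sub_one_le hs1]
  have ht8' : 1 / (s - 1) ≤ 1 / 8 := by
    rw [div_le_div_iff₀ (by linarith) (by norm_num)]; linarith
  set c : ℝ := Real.log (s - 1) - L with hcdef
  rcases le_or_gt c (1 / 2) with hc | hc
  · -- crude case: `∫ a ≤ a(s-1)`
    have hmonoA : ∫ x in (s - 1)..s, majA κ β x ≤ ∫ x in (s - 1)..s, majA κ β (s - 1) :=
      intervalIntegral.integral_mono_on (by linarith) hiA intervalIntegrable_const fun x hx =>
        majA_antitoneOn hκ hβ h0 hg (show β + 1 ≤ s - 1 by linarith)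
          (show β + 1 ≤ x by linarith [hx.1]) hx.1
    rw [intervalIntegral.integral_const, smul_eq_mul, show s - (s - 1) = (1:ℝ) by ring, one_mul]
      at hmonoA
    have h1 : s * majA κ β s ≤ κ * (1 + A / s) * majA κ β (s - 1) :=
      hstar.trans (mul_le_mul_of_nonneg_left hmonoA (by positivity))
    have h2 : (Real.log s - L) * (1 + A / s) < 1 := by
      have h2a : Real.log s - L ≤ 5 / 8 := by linarith
      have h2b : (Real.log s - L) * (1 + A / s) ≤ 5 / 8 * (1 + A / s) :=
        mul_le_mul_of_nonneg_right h2a (by linarith)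
      linarith
    calc s * (Real.log s - L) * majA κ β s = (Real.log s - L) * (s * majA κ β s) := by ring
      _ ≤ (Real.log s - L) * (κ * (1 + A / s) * majA κ β (s - 1)) :=
          mul_le_mul_of_nonneg_left h1 hlogL.le
      _ = ((Real.log s - L) * (1 + A / s)) * (κ * majA κ β (s - 1)) := by ring
      _ < 1 * (κ * majA κ β (s - 1)) := mul_lt_mul_of_pos_right h2 hκa
      _ = κ * majA κ β (s - 1) := one_mul _
  · -- decay case
    have hc0 : 0 < c := by linarith
    have hder : ∀ x ∈ Ioo (s - 1) (s - 1 + 1), HasDerivAt (majA κ β)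
        ((-(κ + 1) * majA κ β x - κ * majA κ β (x - 1)) / x) x := fun x hx =>
      hasDerivAt_majA_of_gt hβ (by linarith [hx.1])
    have hle : ∀ x ∈ Ioo (s - 1) (s - 1 + 1),
        (-(κ + 1) * majA κ β x - κ * majA κ β (x - 1)) / x ≤ -c * majA κ β x := by
      intro x hx
      have hx0 : 0 < x := by linarith [hx.1]
      have hax : 0 < majA κ β x := majA_pos hκ hβ h0 hg hx0
      have hIHx := hIH x hx.1.le (by linarith [hx.2])
      have hlogx : c ≤ Real.log x - L := by
        have := Real.log_le_log (by linarith : 0 < s - 1) hx.1.le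
        rw [hcdef]; linarith
      rw [div_le_iff₀ hx0]
      have h1 : x * c * majA κ β x ≤ x * (Real.log x - L) * majA κ β x := by
        have := mul_le_mul_of_nonneg_left hlogx hx0.le
        exact mul_le_mul_of_nonneg_right this hax.le
      nlinarith
    have hcont' : ContinuousOn (majA κ β) (Icc (s - 1) (s - 1 + 1)) := by
      rw [show s - 1 + 1 = s by ring]; exact hcontA
    have hdecay := integral_le_of_deriv_le hc0 hcont' hder hle
    rw [show s - 1 + 1 = s by ring] at hdecay
    -- the numerical inequality `(log s - L)(1 + A/s)(1 - e^{-c}) < c`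
    have hexpc : Real.exp (-c) = Real.exp L / (s - 1) := by
      rw [hcdef, show -(Real.log (s - 1) - L) = L - Real.log (s - 1) by ring, Real.exp_sub,
        Real.exp_log (by linarith)]
    set t : ℝ := 1 / (s - 1) with htdef
    have ht0 : 0 < t := by positivity
    have hAt : A / s ≤ A * t := by
      rw [htdef, mul_one_div]
      exact div_le_div_of_nonneg_left hA0.le (by linarith) (by linarith)
    have hAt4 : A * t ≤ 1 / 4 := by
      rw [htdef, mul_one_div, div_le_div_iff₀ (by linarith) (by norm_num)]; linarith
    have hEt : Real.exp (-c) = Real.exp L * t := by rw [hexpc, htdef]; ring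
    have hEt1 : Real.exp L * t < 1 := by
      rw [← hEt]; exact Real.exp_lt_one_iff.mpr (by linarith)
    have hnum : (Real.log s - L) * (1 + A / s) * (1 - Real.exp (-c)) < c := by
      have h1 : (Real.log s - L) * (1 + A / s) ≤ c + (c * A + 5 / 4) * t := by
        have h1a : (Real.log s - L) * (1 + A / s) ≤ (c + t) * (1 + A * t) :=
          mul_le_mul (by rw [htdef]; exact hlog) (by linarith) (by positivity) (by linarith)
        have h1b : (c + t) * (1 + A * t) = c + (c * A + 1) * t + (A * t) * t := by ring
        have h1c : (A * t) * t ≤ 1 / 4 * t := mul_le_mul_of_nonneg_right hAt4 ht0.le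
        nlinarith
      rw [hEt]
      have h2 : 0 ≤ 1 - Real.exp L * t := by linarith
      have k1 : c * A + 4 * c ≤ c * Real.exp L := by
        have := mul_le_mul_of_nonneg_left hEL hc0.le
        have e : c * (32 * κ + 4) = c * A + 4 * c := by rw [hAdef]; ring
        linarith
      have k2 : (c * A + 5 / 4) * t < c * Real.exp L * t :=
        mul_lt_mul_of_pos_right (by linarith) ht0
      have k3 : 0 ≤ (c * A + 5 / 4) * Real.exp L * t ^ 2 := by positivity
      calc (Real.log s - L) * (1 + A / s) * (1 - Real.exp L * t)
          ≤ (c + (c * A + 5 / 4) * t) * (1 - Real.exp L * t) :=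
            mul_le_mul_of_nonneg_right h1 h2
        _ = c + ((c * A + 5 / 4) * t - c * Real.exp L * t) - (c * A + 5 / 4) * Real.exp L * t ^ 2 := by
            ring
        _ < c := by linarith
    -- assemble
    have hfac : (Real.log s - L) * (1 + A / s) * (1 - Real.exp (-c)) / c < 1 :=
      (div_lt_one hc0).mpr hnum
    calc s * (Real.log s - L) * majA κ β s = (Real.log s - L) * (s * majA κ β s) := by ring
      _ ≤ (Real.log s - L) * (κ * (1 + A / s) * ∫ x in (s - 1)..s, majA κ β x) :=
          mul_le_mul_of_nonneg_left hstar hlogL.le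
      _ ≤ (Real.log s - L) * (κ * (1 + A / s) * (majA κ β (s - 1) * ((1 - Real.exp (-c)) / c))) := by
          refine mul_le_mul_of_nonneg_left (mul_le_mul_of_nonneg_left hdecay (by positivity)) hlogL.le
      _ = κ * majA κ β (s - 1) * ((Real.log s - L) * (1 + A / s) * (1 - Real.exp (-c)) / c) := by
          field_simp
      _ < κ * majA κ β (s - 1) * 1 := mul_lt_mul_of_pos_left hfac hκa
      _ = κ * majA κ β (s - 1) := mul_one _

/-- **The left half of (6.4) for `a`**: there is `L > 0` with `s (log s − L) a(s) < κ a(s − 1)` for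
all `s > 1` (the bound is empty for `log s ≤ L`), by the continuation argument: at the infimum `u`
of the closed set where it fails it holds on `[u − 1, u)`, and `majA_step_of_forall` gives it at `u`.
[cite: IwaniecActaArith1980, Lemma 13 (6.4)] -/
theorem exists_majA_sub_one_ge :
    ∃ L : ℝ, 0 < L ∧ ∀ s : ℝ, 1 < s → s * (Real.log s - L) * majA κ β s < κ * majA κ β (s - 1) := by
  obtain ⟨s₁, hs₁β, hG⟩ := exists_adjG_add_one_le hκ hβ hg
  set A : ℝ := 32 * κ with hAdef
  set s₂ : ℝ := max (s₁ + 1) (4 * A + 9) with hs₂def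
  have hs₂1 : s₁ + 1 ≤ s₂ := le_max_left _ _
  have hs₂A : 4 * A + 9 ≤ s₂ := le_max_right _ _
  have hA0 : 0 < A := by positivity
  have hs₂0 : 0 < s₂ := by positivity
  set L : ℝ := max (Real.log (A + 4)) (Real.log s₂ + 1) with hLdef
  have hEL : A + 4 ≤ Real.exp L := by
    calc A + 4 = Real.exp (Real.log (A + 4)) := (Real.exp_log (by positivity)).symm
      _ ≤ Real.exp L := Real.exp_le_exp.mpr (le_max_left _ _)
  have hL0 : 0 < L := by
    have : 0 < Real.log s₂ + 1 := by
      have := Real.log_nonneg (show (1:ℝ) ≤ s₂ by linarith); linarith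
    exact lt_of_lt_of_le this (le_max_right _ _)
  -- `e^L ≥ s₂ + 1`
  have hTbig : s₂ + 1 ≤ Real.exp L := by
    have h2 : Real.exp (Real.log s₂ + 1) ≤ Real.exp L := Real.exp_le_exp.mpr (le_max_right _ _)
    rw [Real.exp_add, Real.exp_log hs₂0] at h2
    have h3 : (2:ℝ) ≤ Real.exp 1 := by
      have := Real.add_one_le_exp (1:ℝ); linarith
    nlinarith
  have hT1 : 1 < Real.exp L := by linarith
  -- the trivial zone
  have htriv : ∀ s, 1 < s → Real.log s ≤ L →
      s * (Real.log s - L) * majA κ β s < κ * majA κ β (s - 1) := by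
    intro s hs hsl
    have h1 : s * (Real.log s - L) * majA κ β s ≤ 0 :=
      mul_nonpos_of_nonpos_of_nonneg (mul_nonpos_of_nonneg_of_nonpos (by linarith) (by linarith))
        (majA_pos hκ hβ h0 hg (by linarith)).le
    have h2 : 0 < κ * majA κ β (s - 1) := mul_pos hκ (majA_pos hκ hβ h0 hg (by linarith))
    linarith
  refine ⟨L, hL0, ?_⟩
  by_contra hneg
  push Not at hneg
  obtain ⟨s, hs, hsP⟩ := hneg
  -- the closed bad set beyond `T = e^L`
  set f : ℝ → ℝ := fun u => u * (Real.log u - L) * majA κ β u - κ * majA κ β (u - 1) with hfdef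
  set S : Set ℝ := Ici (Real.exp L) ∩ f ⁻¹' (Ici 0) with hSdef
  have hsT : Real.exp L ≤ s := by
    by_contra h
    push Not at h
    have : Real.log s < L := by
      rw [Real.log_lt_iff_lt_exp (by linarith)]; exact h
    exact absurd (htriv s hs this.le) (not_lt.mpr hsP)
  have hsS : s ∈ S := ⟨hsT, show 0 ≤ f s by simp only [hfdef]; linarith⟩
  have hne : S.Nonempty := ⟨s, hsS⟩
  have hbdd : BddBelow S := ⟨Real.exp L, fun u hu => hu.1⟩
  have hclosed : IsClosed S := by
    have hsub0 : Ici (Real.exp L) ⊆ Ioi (0:ℝ) := fun u (hu : Real.exp L ≤ u) =>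
      show (0:ℝ) < u by linarith
    have hc : ContinuousOn f (Ici (Real.exp L)) := by
      refine ((continuousOn_id.mul ((Real.continuousOn_log.mono fun u hu => ?_).sub
        continuousOn_const)).mul ((continuousOn_majA hβ).mono hsub0)).sub
        (continuousOn_const.mul (((continuousOn_majA hβ).comp (continuousOn_id.sub continuousOn_const)
          fun u (hu : Real.exp L ≤ u) => show (0:ℝ) < id u - 1 by simp only [id]; linarith)))
      exact ne_of_gt (hsub0 hu)
    exact hc.preimage_isClosed_of_isClosed isClosed_Ici isClosed_Ici
  set u := sInf S with hudef
  have huS : u ∈ S := hclosed.csInf_mem hne hbdd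
  have hle_of_mem : ∀ x ∈ S, u ≤ x := fun x hx => csInf_le hbdd hx
  have huT : Real.exp L ≤ u := huS.1
  have huf : 0 ≤ f u := huS.2
  -- the (non-strict) bound below `u`
  have hbelow : ∀ x, 1 < x → x < u → x * (Real.log x - L) * majA κ β x ≤ κ * majA κ β (x - 1) := by
    intro x hx1 hxu
    by_contra hx
    push Not at hx
    rcases lt_or_ge x (Real.exp L) with h | h
    · have : Real.log x < L := by rw [Real.log_lt_iff_lt_exp (by linarith)]; exact h
      linarith [htriv x hx1 this.le]
    · have := hle_of_mem x ⟨h, show 0 ≤ f x by simp only [hfdef]; linarith⟩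
      linarith
  -- the step at `u`
  have hu2 : s₂ + 1 ≤ u := hTbig.trans huT
  have hstep := majA_step_of_forall hκ hβ h0 hg hG (by linarith) (by linarith) (by linarith) hEL
    (s := u) fun x hx1 hx2 => hbelow x (by linarith) hx2
  simp only [hfdef] at huf
  linarith

end Main

end RosserMajorant

end Literature.NumberTheory.Sieve
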